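import Literature.MathematicalPhysics.QuantumFieldTheory.Balaban1983to89.TreeLengthTorusGeometry
import Literature.MathematicalPhysics.QuantumFieldTheory.Dimock2011to13.Phi43PolymerRepresentation
import Summits.QuantumFields.BalabanUV.T4Continuum.Spine.NE1p.DressedOutputAnalyticFaces
import Literature.Probability.LatticeModels.PolymerPressureAnalytic
import Literature.Probability.LatticeModels.PolymerGasRatio
import HarnessLib

/-!
# THE LAST MAYER STEP, DISCHARGED ON THE THREE-TORUS: THE LOGARITHM OF A BAŁABAN POLYMER GAS ((2.11)–(2.13)) WITH SMALL LOCAL ANALYTIC ACTIVITIES IS A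
# LOCALIZED SUM OVER FACE-CONNECTED CUBE POLYMERS WITH BOUNDED ANALYTIC ONE-BOND INTERPOLATIONS (abstract over configurations; no Bałaban density)

Cell `ym3-torus` (YM ladder rung R3 = continuum `SU(2)` Yang–Mills on the three-torus — a RUNG, NOT d = 4, NOT infinite volume, NOT a mass gap, NOT Clay).  Width seat
`ym-ust-20520-w3` (gen 20, LEAD-20520 by lineage); `--supports stmt-QuantumFields-20520 --as helper`, count-neutral, definition-free, default heartbeats.

WHAT.  Ideator g24-3's card for the S2β organ (`Lines/polymer_form.lean` v2, row POLY∘) names as its «FIRST AND LOAD-BEARING NON-PRINT STEP» **(a)**: the most recent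
large-field strata of print's window density are an explicit polymer SUM whose LOGARITHM needs one more convergent Mayer∕polymer-gas step to become a localized sum.  The
analytic edition POLYᵃ∘ (✓`…PolymerAnalyticKnit`) asks the localized terms, polymer by polymer, to be boundary values of BOUNDED ANALYTIC one-bond interpolations with tree
decay.  THIS FILE PROVES THAT STEP for the gas factor, on the papers' own polymer system ([Balaban1988RG2Cluster] (2.11) p.14: polymers = non-empty torus-face-connected cube
sets `TDom 3 N` (= `(tsys 3 N).Dom`), incompatibility `ζ(Z,Z′) = 0` iff `Z ∩ Z′` contains a cube or a wall of a cube = lit `TTouch`), ENTIRELY from landed tree theorems: the (2.12)–(2.13)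
localization `locE` with its (2.41) anchored bound and Kotecký–Preiss holomorphy (lit ✓`B13Resummation.{locE, locE_congr, logZ_eq_sum_locE, kp_condition}`, Summits
✓`…NE1p.DressedOutputAnalyticFaces.analytic_and_bounded_locE_param_of_geometry` over lit ✓`TreeLengthTorusGeometry.tgeometry 3 N`), KP zero-freeness ∕ realness (lit
✓`LatticeModels.{polymerPartitionFunction_ne_zero_of_kp, polymerLogZ_eq_log_of_real, truncatedWeight_eq_zero_of_kp}`) and the cluster geometry «a touching cluster of domains has a face-connected union» (lit
✓`Dimock2011to13.Phi43PolymerRepresentation.tFaceConnected_biUnion_of_isPolymerCluster`, imported; the tree's `B14.Eq347Torus.isTDom_biUnion_of_isPolymerCluster` is the same fact in another currency).  Statement (★★★ `exists_localized_log_gas`): for REAL activities `ρ Z U` of the polymers `Z`, indexed by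
configurations `U : ι → G` of ANY type, that are (1) LOCAL through a cube map `q : ι → TPt 3 N` (`ρ Z U` depends on the coordinates `i` with `q i ∈ Z`), (2) SMALL on a
window `S` — `|ρ Z U| ≤ A·e^{−R·d(Z)}` — and (3) ANALYTIC ALONG ONE-COORDINATE MOVES (for `U, V ∈ S` agreeing off one coordinate: interpolations `k Z : ℂ → ℂ`, differentiable
on `ball 0 Rad`, bounded there by `A·e^{−R·d(Z)}`, `k Z 0 = ρ Z U`, `k Z 1 = ρ Z V`), in the printed regime `r₁ + 2κ₀ + 2 ≤ R`, `A·e^{5r₁+1}·K₀·ν·c₁ ≤ 1` (d = 3: `ν = 7`,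
`c₁ = 32`, `κ₀ = κ₀(32,6)`, `K₀ = K₀(32,6)` of lit `B12TreeDecay`): **there is `T : Finset (TPt 3 N) → (ι → G) → ℝ`, LOCAL in the same sense, SUPPORTED on
face-connected polymers, with ANALYTIC one-coordinate interpolations bounded by `e·ν·c₁·K₀²·A·e^{−r₁·d(Y)}` on the same ball, such that `Ξ(U) > 0` and
`log Ξ(U) = Σ_Y T Y U` for every `U ∈ S`**, where `Ξ(U)` is the hard-core partition function (2.11) of the activities `ρ · U` — `T Y U := Re E(Y)`, `E` = (2.13).
* §1 `sum_univ_eq_sum_of_vanish_off` (generic); ★`isKPVolume_tgeometry` — KP for activities `‖w Z‖ ≤ A e^{−R d(Z)}` on `tgeometry 3 N` (the internal step of lit ✓`exp_sum_locE_eq_Z`, exported); `locE_im_eq_zero`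
  (real activities in the KP regime ⇒ `E(Y)` real); `locE_eq_zero_of_not_isTDom` (under KP, `E(Y) = 0` unless `Y` is a non-empty face-connected polymer — clusters of touching
  domains have domain unions); `log_re_ppf_eq_sum_re_locE` (`Ξ > 0` and `log Ξ = Σ_Y Re E(Y)` over ALL cube sets).
* §2 ★★★ `exists_localized_log_gas`.
Sibling (same hour, independent LOCATE of the same BUILT layer): ym-ust-20520-w4 g19's ✓`…PolymerClusterAnalytic` (p773317) — the KP-parameter holomorphy of
`polymerLogZ` ∕ `truncatedWeight` ∕ `locE` in LETTER form (`exists_analytic_interpolant_locE`, bound as a hypothesis); this file takes the bound from the spine face instead.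
Consumer: the T³ instantiation «GASᵃ∘ (print's large-field strata gas, [Balaban1989LargeFieldII] (1.98)–(1.100) p.390) ⟹ its contribution to POLYᵃ∘» is now a matter of
adding localized sums; with ✓`…PolymerAnalyticKnit` (Schwarz) and ✓`…PolymerTreeKnit` ((1.26)), of the card's four named non-print steps only (b) the dictionary `descend`∕`ℰp` and
(d) torons remain outside the kernel.

HONEST SCOPE.  Polymer-gas bookkeeping over landed Literature∕Summits theorems; the activity letters (1)–(3) are HYPOTHESES; nothing of Bałaban's densities is asserted or proved;
POLYᵃ∘ ∕ POLY∘ ∕ S2β ∕ `FluctuationComparisonRegPrIntL` (20520) NOT proved; no summit is proved by a helper; rung R3 = SU(2) YM₃ on T³ — NOT d = 4, NOT infinite volume, NOT a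
mass gap, NOT Clay.  Sorry-free, axioms standard.

References: [Balaban1988RG2Cluster] CMP 116 (1988) 1–22 ((2.11)–(2.13) p.14, (1.26) p.8, (2.27) p.18, (2.38) p.20, (2.41) p.21); [KoteckyPreiss1986] CMP 103 (1986) 491–498 (Theorem p.492); [Balaban1989LargeFieldII] CMP 122 (1989) 355–392 ((1.98)–(1.100) p.390).
-/

set_option autoImplicit false

noncomputable section

namespace Summit.QuantumFields.YangMills.Theorems.FluctuationComparisonRegPrIntLPolymerMayerGas

open scoped BigOperators
open Literature.MathematicalPhysics.QuantumFieldTheory.Balaban1983to89 (LocDomainSys)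
open Literature.MathematicalPhysics.QuantumFieldTheory.Balaban1983to89.TreeLengthTorus (TPt TDom IsTDom tsys TFaceConnected TLinked TStepIn torusTreeLen torusTreeLen_nonneg)
open Literature.MathematicalPhysics.QuantumFieldTheory.Balaban1983to89.TreeLengthTorusGeometry (TTouch tgeometry ttouch_refl ttouch_symm)
open Literature.MathematicalPhysics.QuantumFieldTheory.Balaban1983to89.B13Resummation (locE locE_congr logZ_eq_sum_locE kp_condition exp_sum_locE_eq_Z)
open Literature.MathematicalPhysics.QuantumFieldTheory.Balaban1983to89.B13FamilySum (coveringFamilies mem_coveringFamilies)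
open Literature.MathematicalPhysics.QuantumFieldTheory.Balaban1983to89.B12TreeDecay (kappa₀ K₀)
open Literature.Probability.LatticeModels
open Summit.QuantumFields.BalabanUV.T4Continuum.NE1p.DressedOutputAnalyticFaces (analytic_and_bounded_locE_param_of_geometry)

variable {N : ℕ} [NeZero N]

/-! ## §1 Plumbing over the tree's Kotecký–Preiss ∕ (2.13) layer on `tgeometry 3 N` -/

/-- A finite sum over a type equals the sum over any finite set off which the summand vanishes (generic bookkeeping, stated once to keep the instance
path of `Finset.univ` single). [folklore] -/
theorem sum_univ_eq_sum_of_vanish_off {α : Type*} [Fintype α] (s : Finset α) (g : α → ℝ) (h : ∀ a, a ∉ s → g a = 0) :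
    ∑ a, g a = ∑ a ∈ s, g a :=
  (Finset.sum_subset (Finset.subset_univ s) fun a _ ha => h a ha).symm

open Classical in
/-- ★ **THE KOTECKÝ–PREISS CONDITION FOR ACTIVITIES `‖w Z‖ ≤ A·e^{−R·d(Z)}` ON THE THREE-TORUS POLYMER SYSTEM** in the regime `r₁ + 2κ₀ + 2 ≤ R`,
`A·e^{5r₁+1}·K₀·ν·c₁ ≤ 1` of the torus geometry `tgeometry 3 N` (`ν = 7`, `c₁ = 32`, `κ₀ = κ₀(32,6)`, `K₀ = K₀(32,6)` — lit `tgeometry_consts`; any `r₁ ≥ 0`): the internal step of lit ✓`B13Resummation.exp_sum_locE_eq_Z` (`kp_condition` + `kp_hypothesis_of_fintype` + `isKPVolume_of_tsum_le`)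
at the torus geometry, with `τ := A·e^{5r₁+1}·K₀·ν`, `s := 0`, `b := 5r₁`, EXPORTED. [cite: Balaban1988RG2Cluster, (2.11) p.14 and (1.26) p.8; KoteckyPreiss1986, Theorem p.492] -/
theorem isKPVolume_tgeometry {w : TDom 3 N → ℂ} {A R r₁ : ℝ} (hA : 0 ≤ A) (hr₁ : 0 ≤ r₁)
    (hrate : r₁ + 2 * (tgeometry 3 N).κ₀ + 2 ≤ R)
    (hsmall : A * Real.exp (5 * r₁ + 1) * (tgeometry 3 N).K₀ * (tgeometry 3 N).ν * (tgeometry 3 N).c₁ ≤ 1)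
    (hw : ∀ Z, ‖w Z‖ ≤ A * Real.exp (-(R * torusTreeLen Z.1))) :
    IsKPVolume TTouch w (fun Z : TDom 3 N => A * Real.exp (5 * r₁ + 1) * (tgeometry 3 N).K₀ * (tgeometry 3 N).ν * ((Z.1.card : ℕ) : ℝ))
      (Finset.univ : Finset (TDom 3 N)) := by
  classical
  have hK₀ : 0 ≤ (tgeometry 3 N).K₀ := (tgeometry 3 N).K₀_nonneg
  have hν : 0 ≤ (tgeometry 3 N).ν := (tgeometry 3 N).ν_nonneg
  have hc₁ : 0 ≤ (tgeometry 3 N).c₁ := (tgeometry 3 N).c₁_nonneg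
  have hκ₀ : 0 ≤ (tgeometry 3 N).κ₀ := (tgeometry 3 N).κ₀_nonneg
  set τ : ℝ := A * Real.exp (5 * r₁ + 1) * (tgeometry 3 N).K₀ * (tgeometry 3 N).ν with hτ
  have hτ0 : 0 ≤ τ := by positivity
  have hτc : τ * (tgeometry 3 N).c₁ ≤ 1 := hsmall
  have hrate' : (tgeometry 3 N).κ₀ + 0 + τ * (tgeometry 3 N).c₁ ≤ R := by linarith
  have hsmall' : A * Real.exp (5 * r₁ + τ * (tgeometry 3 N).c₁) * (tgeometry 3 N).K₀ * (tgeometry 3 N).ν ≤ τ := by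
    have hexp : Real.exp (5 * r₁ + τ * (tgeometry 3 N).c₁) ≤ Real.exp (5 * r₁ + 1) := Real.exp_le_exp.2 (by linarith)
    calc A * Real.exp (5 * r₁ + τ * (tgeometry 3 N).c₁) * (tgeometry 3 N).K₀ * (tgeometry 3 N).ν
        ≤ A * Real.exp (5 * r₁ + 1) * (tgeometry 3 N).K₀ * (tgeometry 3 N).ν := by gcongr
      _ = τ := rfl
  have hw' : ∀ Z, ‖w Z‖ ≤ A * Real.exp (-(R * (tsys 3 N).dj Z)) := fun Z => hw Z
  have hkp := kp_condition (tgeometry 3 N).ι (cubes := (tgeometry 3 N).cubes) (reach := (tgeometry 3 N).reach) (d := (tsys 3 N).dj)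
    (w := w) (A := A) (R := R) (κ₀ := (tgeometry 3 N).κ₀) (K₀ := (tgeometry 3 N).K₀) (c₁ := (tgeometry 3 N).c₁) (τ := τ) (s := 0)
    (b := 5 * r₁) (ν := (tgeometry 3 N).ν) (tgeometry 3 N).loc (tgeometry 3 N).reach_le (tsys 3 N).dj_nonneg hA hK₀ hτ0 hw'
    (tgeometry 3 N).ineq126 (tgeometry 3 N).volBound hrate' hsmall'
  have h1 := fun γ => kp_hypothesis_of_fintype (inc := (tgeometry 3 N).ι) (w := w)
    (a := fun Z => τ * (((tgeometry 3 N).cubes Z).card : ℝ)) (d := fun Z => 0 * (tsys 3 N).dj Z + 5 * r₁) hkp γ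
  have hdK : ∀ Z : TDom 3 N, 0 ≤ 0 * (tsys 3 N).dj Z + 5 * r₁ := fun Z => by rw [zero_mul, zero_add]; positivity
  have hKP : IsKPVolume (tgeometry 3 N).ι w (fun Z => τ * (((tgeometry 3 N).cubes Z).card : ℝ)) (Finset.univ : Finset (TDom 3 N)) :=
    isKPVolume_of_tsum_le (inc := (tgeometry 3 N).ι) (w := w) (a := fun Z => τ * (((tgeometry 3 N).cubes Z).card : ℝ))
      (d := fun Z => 0 * (tsys 3 N).dj Z + 5 * r₁) hdK h1 Finset.univ
  exact hKP

open Classical in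
/-- Under KP (any size function), the (2.13) localization `E(Y)` of REAL activities is REAL: every Kotecký–Preiss logarithm of a sub-volume along the real ray is the
real logarithm of a positive number (lit ✓`polymerLogZ_eq_log_of_real`, zero-freeness ✓`polymerPartitionFunction_ne_zero_of_kp`), and `E(Y)` is a finite signed sum of them.
[cite: KoteckyPreiss1986, Theorem p.492 and (3); Balaban1988RG2Cluster, (2.13) p.14] -/
theorem locE_im_eq_zero {w : TDom 3 N → ℂ} {a : TDom 3 N → ℝ} (hKP : IsKPVolume TTouch w a (Finset.univ : Finset (TDom 3 N)))
    (hreal : ∀ Z, (w Z).im = 0) (Y : Finset (TPt 3 N)) :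
    (locE TTouch (fun Z : TDom 3 N => Z.1) w Y).im = 0 := by
  classical
  haveI : Std.Refl (TTouch (d := 3) (N := N)) := ⟨ttouch_refl⟩
  haveI : Std.Symm (TTouch (d := 3) (N := N)) := ⟨ttouch_symm⟩
  -- along the real ray `t • w`, `t ∈ [0,1]`, the norms do not increase, so KP and zero-freeness persist on every sub-volume
  have hZ : ∀ (B : Finset (TDom 3 N)), ∀ t ∈ Set.Icc (0 : ℝ) 1,
      polymerPartitionFunction TTouch (fun γ => (t : ℂ) * w γ) B ≠ 0 := by
    intro B t ht
    have hKPt : IsKPVolume TTouch (fun γ => (t : ℂ) * w γ) a (Finset.univ : Finset (TDom 3 N)) :=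
      hKP.of_norm_le fun γ _ => by
        rw [norm_mul, Complex.norm_real, Real.norm_eq_abs, abs_of_nonneg ht.1]
        exact mul_le_of_le_one_left (norm_nonneg _) ht.2
    exact polymerPartitionFunction_ne_zero_of_kp hKPt (Finset.subset_univ B)
  have hlog : ∀ B : Finset (TDom 3 N), (polymerLogZ TTouch w B).im = 0 := by
    intro B
    rw [(polymerLogZ_eq_log_of_real (inc := TTouch) hreal (hZ B)).2, Complex.ofReal_im]
  unfold locE truncatedWeight
  rw [Complex.im_sum]
  refine Finset.sum_eq_zero fun C _ => ?_
  rw [Complex.im_sum]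
  refine Finset.sum_eq_zero fun B _ => ?_
  rw [Complex.mul_im, hlog B, mul_zero, zero_add]
  have : ((-1 : ℂ) ^ (C \ B).card).im = 0 := by
    rcases neg_one_pow_eq_or ℂ (C \ B).card with h | h <;> simp [h]
  rw [this, zero_mul]

open Classical in
/-- Under KP, `E(Y) = 0` unless `Y` is a non-empty face-connected cube polymer: a covering family with non-zero truncated functional is a `TTouch`-cluster (lit
✓`truncatedWeight_eq_zero_of_kp`), a non-empty cluster of touching domains has a domain union (lit ✓`Dimock2011to13.tFaceConnected_biUnion_of_isPolymerCluster`), and the empty family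
contributes `log Ξ(∅) = 0` (lit ✓`polymerLogZ_empty`). [cite: Balaban1988RG2Cluster, (2.13) p.14 and (2.27) p.18] -/
theorem locE_eq_zero_of_not_isTDom {w : TDom 3 N → ℂ} {a : TDom 3 N → ℝ} (hKP : IsKPVolume TTouch w a (Finset.univ : Finset (TDom 3 N)))
    {Y : Finset (TPt 3 N)} (hY : ¬ IsTDom Y) : locE TTouch (fun Z : TDom 3 N => Z.1) w Y = 0 := by
  classical
  haveI : Std.Refl (TTouch (d := 3) (N := N)) := ⟨ttouch_refl⟩
  haveI : Std.Symm (TTouch (d := 3) (N := N)) := ⟨ttouch_symm⟩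
  unfold locE
  refine Finset.sum_eq_zero fun C hC => ?_
  obtain ⟨-, hCY⟩ := mem_coveringFamilies.1 hC
  by_cases hcl : IsPolymerCluster TTouch C
  · rcases C.eq_empty_or_nonempty with hCe | hCne
    · subst hCe
      unfold truncatedWeight
      simp [polymerLogZ_empty]
    · exfalso
      refine hY ⟨?_, ?_⟩
      · obtain ⟨Z, hZ⟩ := hCne
        obtain ⟨p, hp⟩ := Z.2.1
        exact ⟨p, hCY ▸ Finset.mem_biUnion.2 ⟨Z, hZ, hp⟩⟩
      · exact hCY ▸ Literature.MathematicalPhysics.QuantumFieldTheory.Dimock2011to13.tFaceConnected_biUnion_of_isPolymerCluster hcl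
  · exact truncatedWeight_eq_zero_of_kp hKP (Finset.subset_univ C) hcl

open Classical in
/-- **`Ξ > 0` AND `log Ξ = Σ_Y Re E(Y)` OVER ALL CUBE SETS** for real activities `‖w Z‖ ≤ A·e^{−R·d(Z)}` in the printed regime: lit ✓`B13Resummation.exp_sum_locE_eq_Z`
((2.11)–(2.13) + [KP86]: `exp(Σ_X E(X)) = Ξ` over the unions, at the torus geometry with `τ := A·e^{5r₁+1}·K₀·ν`, `s := 0`, `b := 5r₁`) with every `E(X)` real
(`locE_im_eq_zero`), so `Ξ = e^{Re Σ} > 0`; off the unions `E(Y) = 0` (no covering family). [cite: Balaban1988RG2Cluster, (2.11)–(2.13) p.14; KoteckyPreiss1986, Theorem p.492] -/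
theorem log_re_ppf_eq_sum_re_locE {w : TDom 3 N → ℂ} {A R r₁ : ℝ} (hA : 0 ≤ A) (hr₁ : 0 ≤ r₁)
    (hrate : r₁ + 2 * (tgeometry 3 N).κ₀ + 2 ≤ R)
    (hsmall : A * Real.exp (5 * r₁ + 1) * (tgeometry 3 N).K₀ * (tgeometry 3 N).ν * (tgeometry 3 N).c₁ ≤ 1)
    (hw : ∀ Z, ‖w Z‖ ≤ A * Real.exp (-(R * torusTreeLen Z.1))) (hreal : ∀ Z, (w Z).im = 0) :
    0 < (polymerPartitionFunction TTouch w (Finset.univ : Finset (TDom 3 N))).re ∧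
      Real.log (polymerPartitionFunction TTouch w (Finset.univ : Finset (TDom 3 N))).re =
        ∑ Y : Finset (TPt 3 N), (locE TTouch (fun Z : TDom 3 N => Z.1) w Y).re := by
  haveI : Std.Refl (TTouch (d := 3) (N := N)) := ⟨ttouch_refl⟩
  haveI : Std.Symm (TTouch (d := 3) (N := N)) := ⟨ttouch_symm⟩
  have hK₀ : 0 ≤ (tgeometry 3 N).K₀ := (tgeometry 3 N).K₀_nonneg
  have hν : 0 ≤ (tgeometry 3 N).ν := (tgeometry 3 N).ν_nonneg
  have hc₁ : 0 ≤ (tgeometry 3 N).c₁ := (tgeometry 3 N).c₁_nonneg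
  have hκ₀ : 0 ≤ (tgeometry 3 N).κ₀ := (tgeometry 3 N).κ₀_nonneg
  set τ : ℝ := A * Real.exp (5 * r₁ + 1) * (tgeometry 3 N).K₀ * (tgeometry 3 N).ν with hτ
  have hτ0 : 0 ≤ τ := by positivity
  have hτc : τ * (tgeometry 3 N).c₁ ≤ 1 := hsmall
  have hrate' : (tgeometry 3 N).κ₀ + 0 + τ * (tgeometry 3 N).c₁ ≤ R := by linarith
  have hsmall' : A * Real.exp (5 * r₁ + τ * (tgeometry 3 N).c₁) * (tgeometry 3 N).K₀ * (tgeometry 3 N).ν ≤ τ := by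
    have hexp : Real.exp (5 * r₁ + τ * (tgeometry 3 N).c₁) ≤ Real.exp (5 * r₁ + 1) := Real.exp_le_exp.2 (by linarith)
    calc A * Real.exp (5 * r₁ + τ * (tgeometry 3 N).c₁) * (tgeometry 3 N).K₀ * (tgeometry 3 N).ν
        ≤ A * Real.exp (5 * r₁ + 1) * (tgeometry 3 N).K₀ * (tgeometry 3 N).ν := by gcongr
      _ = τ := rfl
  have hw' : ∀ Z, ‖w Z‖ ≤ A * Real.exp (-(R * (tsys 3 N).dj Z)) := fun Z => hw Z
  -- `exp(Σ_X E(X)) = Ξ` ((2.11)–(2.13) + [KP86]) at the torus geometry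
  have hexp := exp_sum_locE_eq_Z TTouch (cubes := fun Z : TDom 3 N => Z.1) (reach := (tgeometry 3 N).reach)
    (d := (tsys 3 N).dj) (w := w) (A := A) (R := R) (κ₀ := (tgeometry 3 N).κ₀) (K₀ := (tgeometry 3 N).K₀) (c₁ := (tgeometry 3 N).c₁)
    (τ := τ) (s := 0) (b := 5 * r₁) (ν := (tgeometry 3 N).ν) (tgeometry 3 N).loc (tgeometry 3 N).reach_le (tsys 3 N).dj_nonneg hA hK₀
    hτ0 le_rfl (by positivity) hw' (tgeometry 3 N).ineq126 (tgeometry 3 N).volBound hrate' hsmall'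
  -- every `E(X)` is real, so `Ξ = exp(real)`: positivity and the real logarithm
  have hKP := isKPVolume_tgeometry (N := N) (w := w) hA hr₁ hrate hsmall hw
  have hSim : (∑ X ∈ (Finset.univ : Finset (TDom 3 N)).powerset.image (fun C => C.biUnion fun Z : TDom 3 N => Z.1),
      locE TTouch (fun Z : TDom 3 N => Z.1) w X).im = 0 := by
    rw [Complex.im_sum]
    exact Finset.sum_eq_zero fun X _ => locE_im_eq_zero hKP hreal X
  have key : ∀ {T Ξ : ℂ}, Complex.exp T = Ξ → T.im = 0 → 0 < Ξ.re ∧ Real.log Ξ.re = T.re := by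
    intro T Ξ h hT
    subst h
    rw [Complex.exp_re, hT, Real.cos_zero, mul_one, Real.log_exp]
    exact ⟨Real.exp_pos _, rfl⟩
  obtain ⟨hpos, hlog⟩ := key hexp hSim
  refine ⟨hpos, hlog.trans ?_⟩
  rw [Complex.re_sum]
  -- the unions carry everything: off the image every covering family is absent
  symm
  refine sum_univ_eq_sum_of_vanish_off _ _ fun Y hY => ?_
  have hempty : coveringFamilies (Finset.univ : Finset (TDom 3 N)) (fun Z : TDom 3 N => Z.1) Y = ∅ := by
    rw [Finset.eq_empty_iff_forall_notMem]
    intro C hC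
    obtain ⟨hCsub, hCY⟩ := mem_coveringFamilies.1 hC
    exact hY (Finset.mem_image.2 ⟨C, Finset.mem_powerset.2 hCsub, hCY⟩)
  have hzero : locE TTouch (fun Z : TDom 3 N => Z.1) w Y = 0 := by
    show (∑ C ∈ coveringFamilies (Finset.univ : Finset (TDom 3 N)) (fun Z : TDom 3 N => Z.1) Y, truncatedWeight TTouch w C) = 0
    rw [hempty, Finset.sum_empty]
  exact (congrArg Complex.re hzero).trans Complex.zero_re

/-! ## §2 The theorem -/

open Classical in
/-- ★★★ **THE LAST MAYER STEP ON T³ (abstract over configurations).**  Polymers = non-empty torus-face-connected cube sets of `TPt 3 N` (lit `tsys 3 N`), hard core = touching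
(cube or wall in common, lit `TTouch` — [Balaban1988RG2Cluster] (2.11) p.14 «ζ(Z,Z′) = 0 if Z ∩ Z′ contains a cube, or a wall of a cube»).  For REAL activities `ρ Z U`
indexed by configurations `U : ι → G` which are LOCAL through a cube map `q` (1), SMALL on a window `S` — `|ρ Z U| ≤ A·e^{−R·d(Z)}` (2) — and ANALYTIC ALONG ONE-COORDINATE
MOVES inside `S` with interpolations bounded by the same majorant on `ball 0 Rad` (3), in the printed regime `r₁ + 2κ₀ + 2 ≤ R`, `A·e^{5r₁+1}·K₀·ν·c₁ ≤ 1`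
(d = 3: `ν = 7`, `c₁ = 32`, `κ₀, K₀` at `(32, 6)`): there is `T : Finset (TPt 3 N) → (ι → G) → ℝ` — `T Y U := Re E(Y)`, `E` the (2.13) localization of `log Ξ` — with
(i) the same locality, (ii) support on non-empty face-connected polymers, (iii) for every one-coordinate move in `S` and every `Y` an interpolation `g`, complex-differentiable on
`ball 0 Rad`, `‖g z‖ ≤ e·ν·c₁·K₀²·A·e^{−r₁·d(Y)}` there (written `Real.exp (-r₁ * d)`, POLYᵃ∘'s currency), `g 0 = T Y U`, `g 1 = T Y V` ((2.41) + [KP86] holomorphy, uniformly in the parameter), and (iv) `Ξ(U) > 0`,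
`log Ξ(U) = Σ_Y T Y U` on `S`. [cite: Balaban1988RG2Cluster, (2.11)-(2.13) p.14 and (2.41) p.21; KoteckyPreiss1986, Theorem p.492; Balaban1989LargeFieldII, (1.98)-(1.100) p.390] -/
theorem exists_localized_log_gas {ι G : Type*} (q : ι → TPt 3 N) (S : Set (ι → G))
    (ρ : TDom 3 N → (ι → G) → ℝ) {A R r₁ Rad : ℝ} (hA : 0 ≤ A) (hr₁ : 0 ≤ r₁)
    (hrate : r₁ + 2 * (tgeometry 3 N).κ₀ + 2 ≤ R)
    (hsmall : A * Real.exp (5 * r₁ + 1) * (tgeometry 3 N).K₀ * (tgeometry 3 N).ν * (tgeometry 3 N).c₁ ≤ 1)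
    (hbound : ∀ Z, ∀ U ∈ S, |ρ Z U| ≤ A * Real.exp (-(R * torusTreeLen Z.1)))
    (hloc : ∀ Z U V, (∀ i, q i ∈ Z.1 → U i = V i) → ρ Z U = ρ Z V)
    (hana : ∀ (i : ι) (U V : ι → G), U ∈ S → V ∈ S → (∀ j, j ≠ i → U j = V j) →
      ∃ k : TDom 3 N → ℂ → ℂ, (∀ Z, DifferentiableOn ℂ (k Z) (Metric.ball 0 Rad)) ∧
        (∀ Z, ∀ z ∈ Metric.ball (0 : ℂ) Rad, ‖k Z z‖ ≤ A * Real.exp (-(R * torusTreeLen Z.1))) ∧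
        (∀ Z, k Z 0 = (ρ Z U : ℂ)) ∧ (∀ Z, k Z 1 = (ρ Z V : ℂ))) :
    ∃ T : Finset (TPt 3 N) → (ι → G) → ℝ,
      (∀ Y U V, (∀ i, q i ∈ Y → U i = V i) → T Y U = T Y V) ∧
      (∀ Y, ¬ TFaceConnected Y → ∀ U, T Y U = 0) ∧
      (∀ (i : ι) (U V : ι → G), U ∈ S → V ∈ S → (∀ j, j ≠ i → U j = V j) → ∀ Y : Finset (TPt 3 N),
        ∃ g : ℂ → ℂ, DifferentiableOn ℂ g (Metric.ball 0 Rad) ∧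
          (∀ z ∈ Metric.ball (0 : ℂ) Rad, ‖g z‖ ≤
            Real.exp 1 * (tgeometry 3 N).ν * (tgeometry 3 N).c₁ * (tgeometry 3 N).K₀ ^ 2 * A * Real.exp (-r₁ * torusTreeLen Y)) ∧
          g 0 = (T Y U : ℂ) ∧ g 1 = (T Y V : ℂ)) ∧
      (∀ U ∈ S, 0 < (polymerPartitionFunction TTouch (fun Z : TDom 3 N => (ρ Z U : ℂ)) Finset.univ).re ∧
        Real.log (polymerPartitionFunction TTouch (fun Z : TDom 3 N => (ρ Z U : ℂ)) Finset.univ).re = ∑ Y : Finset (TPt 3 N), T Y U) := by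
  haveI : Std.Refl (TTouch (d := 3) (N := N)) := ⟨ttouch_refl⟩
  haveI : Std.Symm (TTouch (d := 3) (N := N)) := ⟨ttouch_symm⟩
  have hK₀ : 0 ≤ (tgeometry 3 N).K₀ := (tgeometry 3 N).K₀_nonneg
  have hν : 0 ≤ (tgeometry 3 N).ν := (tgeometry 3 N).ν_nonneg
  have hc₁ : 0 ≤ (tgeometry 3 N).c₁ := (tgeometry 3 N).c₁_nonneg
  have hCst0 : 0 ≤ Real.exp 1 * (tgeometry 3 N).ν * (tgeometry 3 N).c₁ * (tgeometry 3 N).K₀ ^ 2 * A := by positivity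
  -- the (2.13) terms of the gas, kept only on face-connected cube sets (off them they vanish on the window anyway, `locE_eq_zero_of_not_isTDom`)
  refine ⟨fun Y U => if TFaceConnected Y then (locE TTouch (fun Z : TDom 3 N => Z.1) (fun Z => (ρ Z U : ℂ)) Y).re else 0, ?_, ?_, ?_, ?_⟩
  · -- (i) locality, by `locE_congr`
    intro Y U V hUV
    have h : locE TTouch (fun Z : TDom 3 N => Z.1) (fun Z => (ρ Z U : ℂ)) Y =
        locE TTouch (fun Z : TDom 3 N => Z.1) (fun Z => (ρ Z V : ℂ)) Y :=
      locE_congr TTouch fun Z hZ => by rw [hloc Z U V fun i hi => hUV i (hZ hi)]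
    show (if TFaceConnected Y then (locE TTouch (fun Z : TDom 3 N => Z.1) (fun Z => (ρ Z U : ℂ)) Y).re else 0 : ℝ) =
      (if TFaceConnected Y then (locE TTouch (fun Z : TDom 3 N => Z.1) (fun Z => (ρ Z V : ℂ)) Y).re else 0 : ℝ)
    rw [h]
  · -- (ii) support
    intro Y hY U
    show (if TFaceConnected Y then (locE TTouch (fun Z : TDom 3 N => Z.1) (fun Z => (ρ Z U : ℂ)) Y).re else 0 : ℝ) = 0
    rw [if_neg hY]
  · -- (iii) analytic one-coordinate interpolations: `g z := E_z(Y)` for the interpolated activities, by (2.41) + [KP86] holomorphy over `tgeometry 3 N`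
    intro i U V hU hV hUV Y
    obtain ⟨k, hkd, hkb, hk0, hk1⟩ := hana i U V hU hV hUV
    by_cases hYc : TFaceConnected Y
    · rcases Y.eq_empty_or_nonempty with hYe | hYne
      · -- the empty set: no domain lies inside, `E(∅) = Φ^T(∅) = 0`
        subst hYe
        have hzero : ∀ w : TDom 3 N → ℂ, locE TTouch (fun Z : TDom 3 N => Z.1) w ∅ = 0 := by
          intro w
          unfold locE
          refine Finset.sum_eq_zero fun C hC => ?_
          obtain ⟨-, hCY⟩ := mem_coveringFamilies.1 hC
          have hCe : C = ∅ := by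
            rw [Finset.eq_empty_iff_forall_notMem]
            intro Z hZ
            obtain ⟨x, hx⟩ := Z.2.1
            have : x ∈ C.biUnion (fun Z : TDom 3 N => Z.1) := Finset.mem_biUnion.2 ⟨Z, hZ, hx⟩
            rw [hCY] at this
            exact Finset.notMem_empty x this
          subst hCe
          unfold truncatedWeight
          simp [polymerLogZ_empty]
        refine ⟨fun _ => 0, differentiableOn_const 0, fun z _ => ?_, ?_, ?_⟩
        · rw [norm_zero]; positivity
        · show (0 : ℂ) = ((if TFaceConnected (∅ : Finset (TPt 3 N)) then
              (locE TTouch (fun Z : TDom 3 N => Z.1) (fun Z => (ρ Z U : ℂ)) ∅).re else 0 : ℝ) : ℂ)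
          rw [hzero]; simp
        · show (0 : ℂ) = ((if TFaceConnected (∅ : Finset (TPt 3 N)) then
              (locE TTouch (fun Z : TDom 3 N => Z.1) (fun Z => (ρ Z V : ℂ)) ∅).re else 0 : ℝ) : ℂ)
          rw [hzero]; simp
      · -- a non-empty face-connected `Y` is a domain `X₀`
        set X₀ : TDom 3 N := ⟨Y, hYne, hYc⟩ with hX₀
        have hface := analytic_and_bounded_locE_param_of_geometry (tgeometry 3 N) (m := fun Z => A * Real.exp (-(R * (tsys 3 N).dj Z)))
          (act := fun z Z => k Z z) (A := A) (R := R) (r₁ := r₁) X₀ (U := Metric.ball (0 : ℂ) Rad) Metric.isOpen_ball hA hr₁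
          hrate hsmall (fun Z _ => hkd Z) (fun z hz Z _ => hkb Z z hz) (fun Z _ => le_rfl)
        obtain ⟨hdiff, hbd⟩ := hface
        -- `(tgeometry 3 N).cubes X₀ = Y`, `(tgeometry 3 N).ι = TTouch`, `(tsys 3 N).dj X₀ = torusTreeLen Y` definitionally
        refine ⟨fun z => locE TTouch (fun Z : TDom 3 N => Z.1) (fun Z => k Z z) Y, hdiff, fun z hz => by rw [neg_mul]; exact hbd z hz, ?_, ?_⟩
        · -- at `z = 0` the activities are `ρ · U` (real): `E(Y)` is real, so it equals the cast of its real part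
          have hw : locE TTouch (fun Z : TDom 3 N => Z.1) (fun Z => k Z 0) Y =
              locE TTouch (fun Z : TDom 3 N => Z.1) (fun Z => (ρ Z U : ℂ)) Y := locE_congr TTouch fun Z _ => hk0 Z
          have hKP := isKPVolume_tgeometry (N := N) (w := fun Z => (ρ Z U : ℂ)) hA hr₁ hrate hsmall fun Z => by
            rw [Complex.norm_real, Real.norm_eq_abs]; exact hbound Z U hU
          have him := locE_im_eq_zero hKP (fun Z => Complex.ofReal_im _) Y
          show locE TTouch (fun Z : TDom 3 N => Z.1) (fun Z => k Z 0) Y =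
            ((if TFaceConnected Y then (locE TTouch (fun Z : TDom 3 N => Z.1) (fun Z => (ρ Z U : ℂ)) Y).re else 0 : ℝ) : ℂ)
          rw [if_pos hYc, hw]
          exact (Complex.ext (Complex.ofReal_re _) (by simpa using him.symm)).symm
        · have hw : locE TTouch (fun Z : TDom 3 N => Z.1) (fun Z => k Z 1) Y =
              locE TTouch (fun Z : TDom 3 N => Z.1) (fun Z => (ρ Z V : ℂ)) Y := locE_congr TTouch fun Z _ => hk1 Z
          have hKP := isKPVolume_tgeometry (N := N) (w := fun Z => (ρ Z V : ℂ)) hA hr₁ hrate hsmall fun Z => by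
            rw [Complex.norm_real, Real.norm_eq_abs]; exact hbound Z V hV
          have him := locE_im_eq_zero hKP (fun Z => Complex.ofReal_im _) Y
          show locE TTouch (fun Z : TDom 3 N => Z.1) (fun Z => k Z 1) Y =
            ((if TFaceConnected Y then (locE TTouch (fun Z : TDom 3 N => Z.1) (fun Z => (ρ Z V : ℂ)) Y).re else 0 : ℝ) : ℂ)
          rw [if_pos hYc, hw]
          exact (Complex.ext (Complex.ofReal_re _) (by simpa using him.symm)).symm
    · -- not face-connected: `T Y ≡ 0`
      refine ⟨fun _ => 0, differentiableOn_const 0, fun z _ => ?_, ?_, ?_⟩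
      · rw [norm_zero]; positivity
      · show (0 : ℂ) = ((if TFaceConnected Y then (locE TTouch (fun Z : TDom 3 N => Z.1) (fun Z => (ρ Z U : ℂ)) Y).re else 0 : ℝ) : ℂ)
        rw [if_neg hYc]; simp
      · show (0 : ℂ) = ((if TFaceConnected Y then (locE TTouch (fun Z : TDom 3 N => Z.1) (fun Z => (ρ Z V : ℂ)) Y).re else 0 : ℝ) : ℂ)
        rw [if_neg hYc]; simp
  · -- (iv) `Ξ(U) > 0` and `log Ξ(U) = Σ_Y T Y U` on the window
    intro U hU
    have hwU : ∀ Z : TDom 3 N, ‖(ρ Z U : ℂ)‖ ≤ A * Real.exp (-(R * torusTreeLen Z.1)) := fun Z => by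
      rw [Complex.norm_real, Real.norm_eq_abs]; exact hbound Z U hU
    have hKP := isKPVolume_tgeometry (N := N) (w := fun Z => (ρ Z U : ℂ)) hA hr₁ hrate hsmall hwU
    obtain ⟨hpos, hlog⟩ := log_re_ppf_eq_sum_re_locE (w := fun Z => (ρ Z U : ℂ)) hA hr₁ hrate hsmall hwU (fun Z => Complex.ofReal_im _)
    refine ⟨hpos, hlog.trans (Finset.sum_congr rfl fun Y _ => ?_)⟩
    show (locE TTouch (fun Z : TDom 3 N => Z.1) (fun Z => (ρ Z U : ℂ)) Y).re =
      (if TFaceConnected Y then (locE TTouch (fun Z : TDom 3 N => Z.1) (fun Z => (ρ Z U : ℂ)) Y).re else 0 : ℝ)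
    by_cases hYc : TFaceConnected Y
    · rw [if_pos hYc]
    · rw [if_neg hYc]
      have hnot : ¬ IsTDom Y := fun h => hYc h.2
      have h0 := locE_eq_zero_of_not_isTDom hKP hnot
      exact (congrArg Complex.re h0).trans Complex.zero_re

end Summit.QuantumFields.YangMills.Theorems.FluctuationComparisonRegPrIntLPolymerMayerGas

end
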